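import Summits.AtomisticToContinuum.HydrodynamicLimit.Theorems.OneFlightGossipEngineSuperExponentialEnergyTailsDefsB
import Literature.MathematicalPhysics.KineticTheory.HardSphereTwoTimePressure
import Literature.Analysis.FluidPDE.EmpiricalCollisionMeasureMeasurableLabels
import HarnessLib

/-!
# Line `Sketch` of crux `SuperExponentialEnergyTails` (stmt-AtomisticToContinuum-17701): the true-law moments
# read in `ℝ` (support file of stub `stub_gevreyHierarchyOfInputs`, stage 1 of 2)

Support file (`--supports stmt-AtomisticToContinuum-17701`) of line Sketch, worker MI.  The registered stub
`stub_gevreyHierarchyOfInputs : GevreyInduction → MomentRegularity → PovznerCeiling → ChaosCeiling → RateFloor →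
VelocityMomentGevreyHierarchy (3/2)` assembles, for `N` large, the `MomentSystem` (DefsB §5) of the real-valued
moments `m_N p s := (velMoment (Φ N) λ_N p s).toReal` of the local Gibbs law transported by the flow.  This file is
the `ℝ≥0∞ ↔ ℝ` bookkeeping of that assembly, under `MomentRegularityFor σ a₀ u₀ θ₀` (DefsB §4):

* `velMoment_eq_ofReal`, `continuousOn_toReal_velMoment`, `toReal_velMoment_zero`, `toReal_velMoment_two_le`,
  `toReal_velMoment_lyapunov`, `toReal_velMoment_initial_le` — the fields `nonneg … initial` of `MomentSystem`;
* `setLIntegral_Ioc_eq_ofReal_intervalIntegral` and its instances `setLIntegral_velMoment_eq`,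
  `setLIntegral_velMoment_mul_add_eq` — the time integrals of the contact inputs `ChaosCeiling` / `RateFloor`
  (DefsB §3) are `ENNReal.ofReal` of interval integrals of continuous functions;
* `preMomentSum_le_pairMomentSum_add` (registered helper stub) — the pre-collisional power sum of order `p` is
  at most the sum of the two pair marks of orders `(p, 0)` and `(0, p)` (pointwise on the good set the three
  collision sums run over the same finite set of records; additivity of the lower integral uses the
  measurability of collision sums of continuous mark functions along the flow,
  `HardSphereFlow.aemeasurable_of_eqOn_collisionSum_labels_torus`, and `ae_mem_good_localGibbsLaw`), so the
  chaos ceiling at orders `(·, 0)`, `(0, ·)` makes every collision power sum finite;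
* `postMomentSum_ne_top`, `toReal_velMoment_sub_eq` — the exact power ledger read in `ℝ`:
  `m p s' - m p s = post.toReal - pre.toReal`.

No new definitions; nothing here is a cited fact (all [folklore] plumbing over DefsB and the prelude).
-/

noncomputable section

namespace Summit.AtomisticToContinuum.HydrodynamicLimit.Theorems.SuperExponentialEnergyTailsHierarchyOfInputs

open scoped BigOperators ENNReal
open MeasureTheory Set
open Literature.MathematicalPhysics.KineticTheory Literature.Analysis.FluidPDE
open Summit.AtomisticToContinuum.HydrodynamicLimit.Theorems.SuperExponentialEnergyTailsLine
  (velMoment preMomentSum postMomentSum pairMomentSum collisionScale VelocityMomentGevreyHierarchy PovznerCeiling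
    ChaosCeiling RateFloor MomentRegularityFor MomentRegularity MomentSystem GevreyInduction stub_collisionScale_pos)

variable {σ : ℝ} {a₀ θ₀ : T3 → ℝ} {u₀ : T3 → V3} {N : ℕ}
  {Φ : HardSphereFlow (Torus.geometry (Fin 3)) (hsDiameter σ N) (N + 1)}

/-! ## The moments in `ℝ` -/

/-- A finite moment is `ofReal` of its real value. [folklore] -/
theorem velMoment_eq_ofReal (hReg : MomentRegularityFor σ a₀ u₀ θ₀) (p : ℕ) (s : ℝ) :
    velMoment Φ (localGibbsLaw σ a₀ u₀ θ₀ N Φ) p s =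
      ENNReal.ofReal (velMoment Φ (localGibbsLaw σ a₀ u₀ θ₀ N Φ) p s).toReal :=
  (ENNReal.ofReal_toReal (hReg.finite N Φ p s).ne).symm

/-- The real moments are continuous on `[0, t]`. [folklore] -/
theorem continuousOn_toReal_velMoment (hReg : MomentRegularityFor σ a₀ u₀ θ₀) (p : ℕ) (t : ℝ) :
    ContinuousOn (fun s => (velMoment Φ (localGibbsLaw σ a₀ u₀ θ₀ N Φ) p s).toReal) (Icc 0 t) :=
  (hReg.continuousOn N Φ p).mono Icc_subset_Ici_self

/-- The real moments are continuous on every `[s, s'] ⊆ [0, ∞)`. [folklore] -/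
theorem continuousOn_toReal_velMoment_Icc (hReg : MomentRegularityFor σ a₀ u₀ θ₀) (p : ℕ) {s : ℝ}
    (hs : 0 ≤ s) (s' : ℝ) :
    ContinuousOn (fun r => (velMoment Φ (localGibbsLaw σ a₀ u₀ θ₀ N Φ) p r).toReal) (Icc s s') :=
  (hReg.continuousOn N Φ p).mono fun _ hr => hs.trans hr.1

/-- Mass: the real moment of order `0` is `1`. [folklore] -/
theorem toReal_velMoment_zero (hReg : MomentRegularityFor σ a₀ u₀ θ₀) (s : ℝ) :
    (velMoment Φ (localGibbsLaw σ a₀ u₀ θ₀ N Φ) 0 s).toReal = 1 := by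
  rw [hReg.mass N Φ s, ENNReal.toReal_one]

/-- Energy: the real second moment is conserved, hence bounded by any bound of its initial value. [folklore] -/
theorem toReal_velMoment_two_le (hReg : MomentRegularityFor σ a₀ u₀ θ₀) {E : ℝ} (hE : 0 ≤ E)
    (h0 : velMoment Φ (localGibbsLaw σ a₀ u₀ θ₀ N Φ) 2 0 ≤ ENNReal.ofReal E) (s : ℝ) :
    (velMoment Φ (localGibbsLaw σ a₀ u₀ θ₀ N Φ) 2 s).toReal ≤ E := by
  rw [hReg.energy N Φ s]
  exact ENNReal.toReal_le_of_le_ofReal hE h0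

/-- Lyapunov's interpolation in `ℝ`. [folklore] -/
theorem toReal_velMoment_lyapunov (hReg : MomentRegularityFor σ a₀ u₀ θ₀) (p₀ p p₁ : ℕ) (h₀ : p₀ < p)
    (h₁ : p < p₁) (s : ℝ) :
    (velMoment Φ (localGibbsLaw σ a₀ u₀ θ₀ N Φ) p s).toReal ≤
      (velMoment Φ (localGibbsLaw σ a₀ u₀ θ₀ N Φ) p₀ s).toReal ^ (((p₁ : ℝ) - p) / ((p₁ : ℝ) - p₀)) *
        (velMoment Φ (localGibbsLaw σ a₀ u₀ θ₀ N Φ) p₁ s).toReal ^ (((p : ℝ) - p₀) / ((p₁ : ℝ) - p₀)) := by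
  have h := hReg.lyapunov N Φ p₀ p p₁ h₀ h₁ s
  have h01 : (p₀ : ℝ) ≤ p₁ := by exact_mod_cast (h₀.trans h₁).le
  have ha : 0 ≤ ((p₁ : ℝ) - p) / ((p₁ : ℝ) - p₀) :=
    div_nonneg (sub_nonneg.2 (by exact_mod_cast h₁.le)) (sub_nonneg.2 h01)
  have hb : 0 ≤ ((p : ℝ) - p₀) / ((p₁ : ℝ) - p₀) :=
    div_nonneg (sub_nonneg.2 (by exact_mod_cast h₀.le)) (sub_nonneg.2 h01)
  rw [ENNReal.toReal_rpow, ENNReal.toReal_rpow, ← ENNReal.toReal_mul]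
  exact ENNReal.toReal_mono (ENNReal.mul_ne_top (ENNReal.rpow_ne_top_of_nonneg ha (hReg.finite N Φ p₀ s).ne)
    (ENNReal.rpow_ne_top_of_nonneg hb (hReg.finite N Φ p₁ s).ne)) h

/-- The Gaussian initial class in `ℝ`. [folklore] -/
theorem toReal_velMoment_initial_le {C₀ A₀ : ℝ} (hC₀ : 0 ≤ C₀) (hA₀ : 0 ≤ A₀) (k : ℕ)
    (h : velMoment Φ (localGibbsLaw σ a₀ u₀ θ₀ N Φ) (2 * k) 0 ≤
      ENNReal.ofReal (C₀ * A₀ ^ k * (k.factorial : ℝ))) :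
    (velMoment Φ (localGibbsLaw σ a₀ u₀ θ₀ N Φ) (2 * k) 0).toReal ≤ C₀ * A₀ ^ k * (k.factorial : ℝ) :=
  ENNReal.toReal_le_of_le_ofReal (by positivity) h

/-! ## Time integrals of the moments -/

/-- A lower integral over `(s, s']` of a function that is `ofReal` of a continuous non-negative function on
`[s, s']` is `ofReal` of the interval integral. [folklore] -/
theorem setLIntegral_Ioc_eq_ofReal_intervalIntegral {s s' : ℝ} (hss' : s ≤ s') {F : ℝ → ℝ} {G : ℝ → ℝ≥0∞}
    (hF : ContinuousOn F (Icc s s')) (hF0 : ∀ r ∈ Icc s s', 0 ≤ F r)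
    (hG : ∀ r ∈ Ioc s s', G r = ENNReal.ofReal (F r)) :
    ∫⁻ r in Ioc s s', G r = ENNReal.ofReal (∫ r in s..s', F r) := by
  rw [setLIntegral_congr_fun measurableSet_Ioc hG, intervalIntegral.integral_of_le hss',
    ofReal_integral_eq_lintegral_ofReal]
  · exact hF.integrableOn_Icc.mono_set Ioc_subset_Icc_self
  · exact (ae_restrict_iff' measurableSet_Ioc).2 (ae_of_all _ fun r hr => hF0 r (Ioc_subset_Icc_self hr))

/-- The time integral of one moment (the `RateFloor` integrals). [folklore] -/
theorem setLIntegral_velMoment_eq (hReg : MomentRegularityFor σ a₀ u₀ θ₀) {s s' : ℝ} (hs : 0 ≤ s)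
    (hss' : s ≤ s') (p : ℕ) :
    ∫⁻ r in Ioc s s', velMoment Φ (localGibbsLaw σ a₀ u₀ θ₀ N Φ) p r =
      ENNReal.ofReal (∫ r in s..s', (velMoment Φ (localGibbsLaw σ a₀ u₀ θ₀ N Φ) p r).toReal) :=
  setLIntegral_Ioc_eq_ofReal_intervalIntegral hss' (continuousOn_toReal_velMoment_Icc hReg p hs s')
    (fun _ _ => ENNReal.toReal_nonneg) fun r _ => velMoment_eq_ofReal hReg p r

/-- The time integral of the symmetrised product of moments (the `ChaosCeiling` integrals). [folklore] -/
theorem setLIntegral_velMoment_mul_add_eq (hReg : MomentRegularityFor σ a₀ u₀ θ₀) {s s' : ℝ} (hs : 0 ≤ s)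
    (hss' : s ≤ s') (a b c d : ℕ) :
    ∫⁻ r in Ioc s s', (velMoment Φ (localGibbsLaw σ a₀ u₀ θ₀ N Φ) a r *
        velMoment Φ (localGibbsLaw σ a₀ u₀ θ₀ N Φ) b r +
      velMoment Φ (localGibbsLaw σ a₀ u₀ θ₀ N Φ) c r * velMoment Φ (localGibbsLaw σ a₀ u₀ θ₀ N Φ) d r) =
      ENNReal.ofReal (∫ r in s..s',
        ((velMoment Φ (localGibbsLaw σ a₀ u₀ θ₀ N Φ) a r).toReal *
            (velMoment Φ (localGibbsLaw σ a₀ u₀ θ₀ N Φ) b r).toReal +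
          (velMoment Φ (localGibbsLaw σ a₀ u₀ θ₀ N Φ) c r).toReal *
            (velMoment Φ (localGibbsLaw σ a₀ u₀ θ₀ N Φ) d r).toReal)) := by
  refine setLIntegral_Ioc_eq_ofReal_intervalIntegral hss' ?_ (fun _ _ => by positivity) fun r _ => ?_
  · exact ((continuousOn_toReal_velMoment_Icc hReg a hs s').mul
      (continuousOn_toReal_velMoment_Icc hReg b hs s')).add
      ((continuousOn_toReal_velMoment_Icc hReg c hs s').mul (continuousOn_toReal_velMoment_Icc hReg d hs s'))
  · rw [ENNReal.ofReal_add (by positivity) (by positivity), ENNReal.ofReal_mul ENNReal.toReal_nonneg,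
      ENNReal.ofReal_mul ENNReal.toReal_nonneg, ← velMoment_eq_ofReal hReg, ← velMoment_eq_ofReal hReg,
      ← velMoment_eq_ofReal hReg, ← velMoment_eq_ofReal hReg]

/-! ## Finiteness of the collision power sums -/

/-- **Registered helper stub.**  The pre-collisional power sum of order `p` of a window is at most the sum of the
pair marks of orders `(p, 0)` and `(0, p)` of the same window (true law, any `0 ≤ σ < 1/2`, any flow): on the good
set the three collision sums are finite sums over the same records and `(a + b)/2 ≤ a·1 + 1·b`; the lower integral
is additive because collision sums of continuous mark functions are a.e.-measurable under the local Gibbs law.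
[folklore] -/
theorem preMomentSum_le_pairMomentSum_add : ∀ (σ : ℝ) (a₀ θ₀ : Literature.MathematicalPhysics.KineticTheory.T3 → ℝ) (u₀ : Literature.MathematicalPhysics.KineticTheory.T3 → Literature.MathematicalPhysics.KineticTheory.V3) (N : ℕ) (Φ : Literature.Analysis.FluidPDE.HardSphereFlow (Literature.Analysis.FluidPDE.Torus.geometry (Fin 3)) (Literature.MathematicalPhysics.KineticTheory.hsDiameter σ N) (N + 1)) (p : ℕ) (s₁ s₂ : ℝ), 0 ≤ σ → σ < 1 / 2 → Summit.AtomisticToContinuum.HydrodynamicLimit.Theorems.SuperExponentialEnergyTailsLine.preMomentSum Φ (Literature.MathematicalPhysics.KineticTheory.localGibbsLaw σ a₀ u₀ θ₀ N Φ) p s₁ s₂ ≤ Summit.AtomisticToContinuum.HydrodynamicLimit.Theorems.SuperExponentialEnergyTailsLine.pairMomentSum Φ (Literature.MathematicalPhysics.KineticTheory.localGibbsLaw σ a₀ u₀ θ₀ N Φ) p 0 s₁ s₂ + Summit.AtomisticToContinuum.HydrodynamicLimit.Theorems.SuperExponentialEnergyTailsLine.pairMomentSum Φ (Literature.MathematicalPhysics.KineticTheory.localGibbsLaw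 σ a₀ u₀ θ₀ N Φ) 0 p s₁ s₂ := by
  intro σ a₀ θ₀ u₀ N Φ p s s' hσ hσ2
  have hae := ae_mem_good_localGibbsLaw σ a₀ u₀ θ₀ N Φ
  have hε : hsDiameter σ N < 2⁻¹ := (hsDiameter_le hσ N).trans_lt (by rw [inv_eq_one_div]; exact hσ2)
  have hW : AEMeasurable (fun z => Φ.collisionSum (Ioc s s')
      (fun c => ‖c.preVel.1‖ ^ p * ‖c.preVel.2‖ ^ 0) z) (localGibbsLaw σ a₀ u₀ θ₀ N Φ) :=
    Φ.aemeasurable_of_eqOn_collisionSum_labels_torus hε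
      (F := fun _ _ m => ‖m.2.2.2.1‖ ^ p * ‖m.2.2.2.2‖ ^ 0) (fun _ _ => by fun_prop) s s'
      (fun z _ => rfl) hae
  have hmeas : AEMeasurable (fun z => ENNReal.ofReal (((N : ℝ) + 1)⁻¹ * Φ.collisionSum (Ioc s s')
      (fun c => ‖c.preVel.1‖ ^ p * ‖c.preVel.2‖ ^ 0) z)) (localGibbsLaw σ a₀ u₀ θ₀ N Φ) :=
    ENNReal.measurable_ofReal.comp_aemeasurable (hW.const_mul _)
  unfold preMomentSum pairMomentSum
  rw [← lintegral_add_left' hmeas]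
  refine lintegral_mono_ae ?_
  filter_upwards [hae] with z hz
  have hfin := Φ.finite_collisionTimes_inter hz (Ioc_subset_Icc_self : Ioc s s' ⊆ Icc s s')
  have hN : 0 ≤ ((N : ℝ) + 1)⁻¹ := by positivity
  simp only [HardSphereFlow.collisionSum_eq, collisionSum_eq_finset_sum hfin, pow_zero, mul_one,
    one_mul]
  have hA : 0 ≤ ∑ t ∈ hfin.toFinset, ∑ q ∈ contactPairs (Torus.geometry (Fin 3)) (hsDiameter σ N) (Φ.flow t z),
      ‖(HardSphereCollisionRecord.ofConfig (Torus.geometry (Fin 3)) (hsDiameter σ N) (Φ.flow t z) t q.1 q.2).preVel.1‖ ^ p :=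
    Finset.sum_nonneg fun _ _ => Finset.sum_nonneg fun _ _ => by positivity
  have hB : 0 ≤ ∑ t ∈ hfin.toFinset, ∑ q ∈ contactPairs (Torus.geometry (Fin 3)) (hsDiameter σ N) (Φ.flow t z),
      ‖(HardSphereCollisionRecord.ofConfig (Torus.geometry (Fin 3)) (hsDiameter σ N) (Φ.flow t z) t q.1 q.2).preVel.2‖ ^ p :=
    Finset.sum_nonneg fun _ _ => Finset.sum_nonneg fun _ _ => by positivity
  rw [← ENNReal.ofReal_add (mul_nonneg hN hA) (mul_nonneg hN hB)]
  refine ENNReal.ofReal_le_ofReal ?_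
  rw [← mul_add, ← Finset.sum_add_distrib]
  refine mul_le_mul_of_nonneg_left ?_ hN
  simp_rw [← Finset.sum_add_distrib]
  refine Finset.sum_le_sum fun t _ => Finset.sum_le_sum fun q _ => ?_
  have h1 : 0 ≤ ‖(HardSphereCollisionRecord.ofConfig (Torus.geometry (Fin 3)) (hsDiameter σ N) (Φ.flow t z) t
      q.1 q.2).preVel.1‖ ^ p := by positivity
  have h2 : 0 ≤ ‖(HardSphereCollisionRecord.ofConfig (Torus.geometry (Fin 3)) (hsDiameter σ N) (Φ.flow t z) t
      q.1 q.2).preVel.2‖ ^ p := by positivity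
  linarith

/-- Finiteness of the pre-collisional power sum from finiteness of the two pair marks. [folklore] -/
theorem preMomentSum_ne_top (hσ : 0 ≤ σ) (hσ2 : σ < 1 / 2) {p : ℕ} {s s' : ℝ}
    (h1 : pairMomentSum Φ (localGibbsLaw σ a₀ u₀ θ₀ N Φ) p 0 s s' ≠ ⊤)
    (h2 : pairMomentSum Φ (localGibbsLaw σ a₀ u₀ θ₀ N Φ) 0 p s s' ≠ ⊤) :
    preMomentSum Φ (localGibbsLaw σ a₀ u₀ θ₀ N Φ) p s s' ≠ ⊤ :=
  ne_top_of_le_ne_top (ENNReal.add_ne_top.2 ⟨h1, h2⟩)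
    (preMomentSum_le_pairMomentSum_add σ a₀ θ₀ u₀ N Φ p s s' hσ hσ2)

/-- Finiteness of the post-collisional power sum, from the ledger. [folklore] -/
theorem postMomentSum_ne_top (hReg : MomentRegularityFor σ a₀ u₀ θ₀) {p : ℕ} {s s' : ℝ} (hs : 0 ≤ s)
    (hss' : s ≤ s') (hpre : preMomentSum Φ (localGibbsLaw σ a₀ u₀ θ₀ N Φ) p s s' ≠ ⊤) :
    postMomentSum Φ (localGibbsLaw σ a₀ u₀ θ₀ N Φ) p s s' ≠ ⊤ := by
  have h := hReg.ledger N Φ p s s' hs hss'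
  refine ne_top_of_le_ne_top (ENNReal.add_ne_top.2 ⟨(hReg.finite N Φ p s').ne, hpre⟩) ?_
  rw [h]
  exact le_add_self

/-- **The exact power ledger in `ℝ`**: `m p s' - m p s = post - pre` as soon as the pre-collisional power sum
of the window is finite. [folklore] -/
theorem toReal_velMoment_sub_eq (hReg : MomentRegularityFor σ a₀ u₀ θ₀) {p : ℕ} {s s' : ℝ} (hs : 0 ≤ s)
    (hss' : s ≤ s') (hpre : preMomentSum Φ (localGibbsLaw σ a₀ u₀ θ₀ N Φ) p s s' ≠ ⊤) :
    (velMoment Φ (localGibbsLaw σ a₀ u₀ θ₀ N Φ) p s').toReal -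
        (velMoment Φ (localGibbsLaw σ a₀ u₀ θ₀ N Φ) p s).toReal =
      (postMomentSum Φ (localGibbsLaw σ a₀ u₀ θ₀ N Φ) p s s').toReal -
        (preMomentSum Φ (localGibbsLaw σ a₀ u₀ θ₀ N Φ) p s s').toReal := by
  have h := congrArg ENNReal.toReal (hReg.ledger N Φ p s s' hs hss')
  rw [ENNReal.toReal_add (hReg.finite N Φ p s').ne hpre,
    ENNReal.toReal_add (hReg.finite N Φ p s).ne (postMomentSum_ne_top hReg hs hss' hpre)] at h
  linarith

/-! ## The contact inputs read in `ℝ` -/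

/-- A `ChaosCeiling`-type bound read in `ℝ`: the pair mark is at most `ofReal` of the constant times the interval
integral (in particular it is finite). [folklore] -/
theorem pairMomentSum_le_ofReal (hReg : MomentRegularityFor σ a₀ u₀ θ₀) {s s' : ℝ} (hs : 0 ≤ s) (hss' : s ≤ s')
    {c : ℝ} (hc : 0 ≤ c) {p p' : ℕ} {a b c' d : ℕ}
    (h : pairMomentSum Φ (localGibbsLaw σ a₀ u₀ θ₀ N Φ) p p' s s' ≤ ENNReal.ofReal c *
      ∫⁻ r in Ioc s s', (velMoment Φ (localGibbsLaw σ a₀ u₀ θ₀ N Φ) a r *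
          velMoment Φ (localGibbsLaw σ a₀ u₀ θ₀ N Φ) b r +
        velMoment Φ (localGibbsLaw σ a₀ u₀ θ₀ N Φ) c' r * velMoment Φ (localGibbsLaw σ a₀ u₀ θ₀ N Φ) d r)) :
    pairMomentSum Φ (localGibbsLaw σ a₀ u₀ θ₀ N Φ) p p' s s' ≤ ENNReal.ofReal (c * ∫ r in s..s',
        ((velMoment Φ (localGibbsLaw σ a₀ u₀ θ₀ N Φ) a r).toReal *
            (velMoment Φ (localGibbsLaw σ a₀ u₀ θ₀ N Φ) b r).toReal +
          (velMoment Φ (localGibbsLaw σ a₀ u₀ θ₀ N Φ) c' r).toReal *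
            (velMoment Φ (localGibbsLaw σ a₀ u₀ θ₀ N Φ) d r).toReal)) := by
  rw [ENNReal.ofReal_mul hc, ← setLIntegral_velMoment_mul_add_eq hReg hs hss' a b c' d]
  exact h

/-- A `RateFloor`-type bound read in `ℝ`. [folklore] -/
theorem rateFloor_toReal (hReg : MomentRegularityFor σ a₀ u₀ θ₀) {s s' : ℝ} (hs : 0 ≤ s) (hss' : s ≤ s')
    {c₁ c₂ : ℝ} (hc₁ : 0 ≤ c₁) (hc₂ : 0 ≤ c₂) {p a b : ℕ}
    (hpre : preMomentSum Φ (localGibbsLaw σ a₀ u₀ θ₀ N Φ) p s s' ≠ ⊤)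
    (h : ENNReal.ofReal c₁ * ∫⁻ r in Ioc s s', velMoment Φ (localGibbsLaw σ a₀ u₀ θ₀ N Φ) a r ≤
      preMomentSum Φ (localGibbsLaw σ a₀ u₀ θ₀ N Φ) p s s' +
        ENNReal.ofReal c₂ * ∫⁻ r in Ioc s s', velMoment Φ (localGibbsLaw σ a₀ u₀ θ₀ N Φ) b r) :
    c₁ * ∫ r in s..s', (velMoment Φ (localGibbsLaw σ a₀ u₀ θ₀ N Φ) a r).toReal ≤
      (preMomentSum Φ (localGibbsLaw σ a₀ u₀ θ₀ N Φ) p s s').toReal +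
        c₂ * ∫ r in s..s', (velMoment Φ (localGibbsLaw σ a₀ u₀ θ₀ N Φ) b r).toReal := by
  have hIa : 0 ≤ ∫ r in s..s', (velMoment Φ (localGibbsLaw σ a₀ u₀ θ₀ N Φ) a r).toReal :=
    intervalIntegral.integral_nonneg hss' fun _ _ => ENNReal.toReal_nonneg
  have hIb : 0 ≤ ∫ r in s..s', (velMoment Φ (localGibbsLaw σ a₀ u₀ θ₀ N Φ) b r).toReal :=
    intervalIntegral.integral_nonneg hss' fun _ _ => ENNReal.toReal_nonneg
  rw [setLIntegral_velMoment_eq hReg hs hss' a, setLIntegral_velMoment_eq hReg hs hss' b,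
    ← ENNReal.ofReal_mul hc₁, ← ENNReal.ofReal_mul hc₂, ← ENNReal.ofReal_toReal hpre,
    ← ENNReal.ofReal_add ENNReal.toReal_nonneg (mul_nonneg hc₂ hIb)] at h
  exact (ENNReal.ofReal_le_ofReal_iff (add_nonneg ENNReal.toReal_nonneg (mul_nonneg hc₂ hIb))).1 h

end Summit.AtomisticToContinuum.HydrodynamicLimit.Theorems.SuperExponentialEnergyTailsHierarchyOfInputs

end
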